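import Summits.AnomalousDissipation.AnomalousDissipation.Theorems.SolenoidalFractalHomogenisationLagrangianStepVmodCoarseLoss
import Summits.AnomalousDissipation.AnomalousDissipation.Theorems.SolenoidalFractalHomogenisationLagrangianStepN1Assembly
import Summits.AnomalousDissipation.AnomalousDissipation.Theorems.SolenoidalFractalHomogenisationLagrangianStepWindowRecursion
import Summits.AnomalousDissipation.AnomalousDissipation.Theorems.SolenoidalFractalHomogenisationLagrangianStepLossCurrencyRefChange
import Literature.Analysis.FluidPDE.PassiveVectorTensorPropagatorDuality
import HarnessLib

/-!
# K1L_D (stmt-AnomalousDissipation-27980): (V_mod) flat stage — SHORT-WINDOW PIECES: the split of a class at a frequency ball, the coarse member as a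
# Fourier multiplier on the two pieces, and the loss currency of each piece
(line file of the (V_mod) lane, short-window engine F4c-1 of the (ff) block (and of (fs)/(sf)); prover ad-k3l-bookkeeping-p1 g9.)

For `x ∈ V2 = L²(𝕋³; ℝ³)` and a level `N`, `x = x_u + x_s` with `x̂_u = 𝟙_{|k| ≤ N} x̂`, `x̂_s = 𝟙_{|k| > N} x̂` (`exists_ballSplit`: the low piece is the
class of the real trigonometric polynomial `fourierTruncate N x`; norms, enstrophy of the low piece, solenoidality of both pieces).  For a
carrier-free window propagator `T` (tensor `NearIso 𝔹 lo′ hi′`, `0 < lo′`) every mode decays (`norm_sq_fcoeff_carrierFree_decay`), so `T` and its adjoint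
keep both Fourier supports and the losses ADD over the split (`lossFwd_ballSplit`, `lossAdj_ballSplit`); the low piece pays in enstrophy currency
(`lossFwd_low_ge`, `lossAdj_low_ge`: `(κτ/2)·Σ_{|k|≤N}|k|²‖x̂ k‖² ≤ q` when `κτN² ≤ 1`, `κ = 8π²lo′`) and the high piece is saturated
(`lossFwd_high_ge`, `lossAdj_high_ge`: `‖x_s‖²/4 ≤ q` when `κτ(N+1)² ≥ 1`).  `sorry`-free; NOT a proof of any block, of the stub, of K1L_D or AD;
rung F-D1.A0.  (The modewise adjoint loss for the literal zero carrier is ad-k1loc-p3 g10's `VmodFlat.lossAdj_ge_sum_modes`; here the carrier is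
any pointwise-zero field, which is what `IsPropagator.adjoint_eq` produces.)
-/

set_option linter.dupNamespace false

noncomputable section

namespace Summit.AnomalousDissipation.AnomalousDissipation.Theorems.SolenoidalFractalHomogenisation.LagrangianStep.VmodFlat

open Literature.Analysis Literature.Analysis.FluidPDE Literature.Analysis.FunctionSpaces
open MeasureTheory Set Filter UnitAddTorus
open scoped ENNReal NNReal InnerProductSpace
open Summit.AnomalousDissipation.AnomalousDissipation.Theorems.SolenoidalFractalHomogenisation.LagrangianStep.CellClauseMod

/-! ## §1 The split at a frequency ball -/

/-- Off the ball `|k| ≤ N` an integer frequency has `|k|² ≥ N² + 1`. [folklore] -/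
theorem freqNormSq_ge_of_not_mem_freqBall {N : ℕ} {k : Fin 3 → ℤ} (hk : k ∉ Torus.freqBall (d := Fin 3) N) :
    (N : ℝ) ^ 2 + 1 ≤ Torus.freqNormSq k := by
  have h1 : ((N : ℝ)) ^ 2 < Torus.freqNormSq k := Torus.not_mem_freqBall.1 hk
  have e : Torus.freqNormSq k = ((∑ i, k i ^ 2 : ℤ) : ℝ) := by
    rw [Torus.freqNormSq]; push_cast; rfl
  rw [e] at h1 ⊢
  have h2 : ((N : ℤ)) ^ 2 < ∑ i, k i ^ 2 := by exact_mod_cast h1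
  have h3 : ((N : ℤ)) ^ 2 + 1 ≤ ∑ i, k i ^ 2 := h2
  exact_mod_cast h3

/-- **The split of an `L²` class at the ball `|k| ≤ N`.**  There are `xu xs ∈ V2` with `xu + xs = x`, `x̂u = 𝟙_{ball} x̂`, `x̂s = 𝟙_{off ball} x̂`,
the low piece has spectral enstrophy `4π² Σ_{|k|≤N} |k|²‖x̂ k‖²`, and both pieces are weakly divergence free when `x` is. [folklore] -/
theorem exists_ballSplit (N : ℕ) (x : V2) :
    ∃ xu xs : V2, xu + xs = x ∧ (∀ k, fc xu k = if k ∈ Torus.freqBall (d := Fin 3) N then fc x k else 0) ∧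
      (∀ k, fc xs k = if k ∈ Torus.freqBall (d := Fin 3) N then 0 else fc x k) ∧
      Torus.eGradNormSq (xu : VF) =
        ENNReal.ofReal (4 * Real.pi ^ 2 * ∑ k ∈ Torus.freqBall (d := Fin 3) N, Torus.freqNormSq k * ‖fc x k‖ ^ 2) ∧
      (Torus.IsWeaklyDivFree (x : VF) → Torus.IsWeaklyDivFree (xu : VF) ∧ Torus.IsWeaklyDivFree (xs : VF)) := by
  set S := Torus.freqBall (d := Fin 3) N with hSdef
  have hS : ∀ k ∈ S, -k ∈ S := Torus.neg_mem_freqBall_of_mem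
  set xu : V2 := (Torus.memLp_realTrigPoly S (fun k => mFourierCoeff (EuclideanSpace.complexify ∘ (⇑x : VF)) k) 2).toLp
    (Torus.realTrigPoly S (fun k => mFourierCoeff (EuclideanSpace.complexify ∘ (⇑x : VF)) k)) with hxu
  have hfu : ∀ k, fc xu k = if k ∈ S then fc x k else 0 := by
    intro k
    rw [fc, hxu, Torus.mFourierCoeff_congr_ae ((MemLp.coeFn_toLp _).fun_comp EuclideanSpace.complexify) k,
      Torus.mFourierCoeff_realTrigPoly hS (N1Assembly.isConjSymm_coeff x) k]
    rfl
  refine ⟨xu, x - xu, add_sub_cancel xu x, hfu, fun k => ?_, N1Assembly.eGradNormSq_piece x hS, fun hx => ?_⟩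
  · rw [fc_sub, hfu k]
    split_ifs <;> simp
  · have hxu_div : Torus.IsWeaklyDivFree (xu : VF) := N1Assembly.isWeaklyDivFree_piece x hx S
    refine ⟨hxu_div, ?_⟩
    have h1 : x ∈ Torus.divFreeL2 (Fin 3) := (Torus.mem_divFreeL2_iff x).2 hx
    have h2 : xu ∈ Torus.divFreeL2 (Fin 3) := (Torus.mem_divFreeL2_iff xu).2 hxu_div
    exact (Torus.mem_divFreeL2_iff _).1 (Submodule.sub_mem _ h1 h2)

/-! ## §2 Consequences of the Fourier description of the two pieces -/

section Pieces

variable {N : ℕ} {x xu xs : V2}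

/-- The two pieces are orthogonal. [folklore] -/
theorem inner_ballSplit_eq_zero (hfu : ∀ k, fc xu k = if k ∈ Torus.freqBall (d := Fin 3) N then fc x k else 0)
    (hfs : ∀ k, fc xs k = if k ∈ Torus.freqBall (d := Fin 3) N then 0 else fc x k) : ⟪xu, xs⟫_ℝ = 0 := by
  refine inner_eq_zero_of_fc_disjoint fun k => ?_
  by_cases hk : k ∈ Torus.freqBall (d := Fin 3) N
  · right; rw [hfs k, if_pos hk]
  · left; rw [hfu k, if_neg hk]

/-- Energy of the low piece: `‖xu‖² = Σ_{|k|≤N} ‖x̂ k‖²`. [folklore] -/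
theorem norm_sq_low_eq (hfu : ∀ k, fc xu k = if k ∈ Torus.freqBall (d := Fin 3) N then fc x k else 0) :
    ‖xu‖ ^ 2 = ∑ k ∈ Torus.freqBall (d := Fin 3) N, ‖fc x k‖ ^ 2 := by
  have hP := hasSum_norm_sq_fcoeff xu
  have h0 : ∀ k, k ∉ Torus.freqBall (d := Fin 3) N → ‖mFourierCoeff (EuclideanSpace.complexify ∘ ⇑xu) k‖ ^ 2 = 0 := fun k hk => by
    rw [show mFourierCoeff (EuclideanSpace.complexify ∘ ⇑xu) k = fc xu k from rfl, hfu k, if_neg hk, norm_zero]; ring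
  have h1 : HasSum (fun k : Fin 3 → ℤ => ‖mFourierCoeff (EuclideanSpace.complexify ∘ ⇑xu) k‖ ^ 2)
      (∑ k ∈ Torus.freqBall (d := Fin 3) N, ‖mFourierCoeff (EuclideanSpace.complexify ∘ ⇑xu) k‖ ^ 2) :=
    hasSum_sum_of_ne_finset_zero h0
  rw [hP.unique h1]
  refine Finset.sum_congr rfl fun k hk => ?_
  rw [show mFourierCoeff (EuclideanSpace.complexify ∘ ⇑xu) k = fc xu k from rfl, hfu k, if_pos hk]

/-- Energies add over the split. [folklore] -/
theorem norm_sq_eq_add (hsum : xu + xs = x) (hfu : ∀ k, fc xu k = if k ∈ Torus.freqBall (d := Fin 3) N then fc x k else 0)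
    (hfs : ∀ k, fc xs k = if k ∈ Torus.freqBall (d := Fin 3) N then 0 else fc x k) : ‖x‖ ^ 2 = ‖xu‖ ^ 2 + ‖xs‖ ^ 2 := by
  have h := norm_add_sq_eq_norm_sq_add_norm_sq_of_inner_eq_zero xu xs (inner_ballSplit_eq_zero hfu hfs)
  rw [hsum] at h
  nlinarith [h]

/-- Fastness passes to both pieces. [folklore] -/
theorem isFast_ballSplit {n : ℕ} (hx : IsFast n x) (hfu : ∀ k, fc xu k = if k ∈ Torus.freqBall (d := Fin 3) N then fc x k else 0)
    (hfs : ∀ k, fc xs k = if k ∈ Torus.freqBall (d := Fin 3) N then 0 else fc x k) : IsFast n xu ∧ IsFast n xs := by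
  refine ⟨fun k hk => ?_, fun k hk => ?_⟩
  · rw [hfu k]; split_ifs <;> first | rfl | exact hx k hk
  · rw [hfs k]; split_ifs <;> first | rfl | exact hx k hk

/-- **A fast low piece is controlled by its enstrophy**: `((n/4)² + 1)·‖xu‖² ≤ Σ_{|k|≤N} |k|²‖x̂ k‖²` for fast `x`. [folklore] -/
theorem norm_sq_low_le_of_isFast {n : ℕ} (hx : IsFast n x) (hfu : ∀ k, fc xu k = if k ∈ Torus.freqBall (d := Fin 3) N then fc x k else 0) :
    ((((n / 4 : ℕ) : ℝ)) ^ 2 + 1) * ‖xu‖ ^ 2 ≤ ∑ k ∈ Torus.freqBall (d := Fin 3) N, Torus.freqNormSq k * ‖fc x k‖ ^ 2 := by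
  rw [norm_sq_low_eq hfu, Finset.mul_sum]
  refine Finset.sum_le_sum fun k _ => ?_
  by_cases hk : k ∈ Torus.freqBall (d := Fin 3) (n / 4)
  · rw [hx k hk, norm_zero]; simp
  · exact mul_le_mul_of_nonneg_right (freqNormSq_ge_of_not_mem_freqBall hk) (sq_nonneg _)

/-- The low piece has finite enstrophy, given by the finite sum. [folklore] -/
theorem eGradNormSq_low_toReal
    (hE : Torus.eGradNormSq (xu : VF) =
      ENNReal.ofReal (4 * Real.pi ^ 2 * ∑ k ∈ Torus.freqBall (d := Fin 3) N, Torus.freqNormSq k * ‖fc x k‖ ^ 2)) :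
    Torus.eGradNormSq (xu : VF) ≠ ⊤ ∧
      (Torus.eGradNormSq (xu : VF)).toReal = 4 * Real.pi ^ 2 * ∑ k ∈ Torus.freqBall (d := Fin 3) N, Torus.freqNormSq k * ‖fc x k‖ ^ 2 := by
  rw [hE]
  refine ⟨ENNReal.ofReal_ne_top, ENNReal.toReal_ofReal ?_⟩
  exact mul_nonneg (by positivity) (Finset.sum_nonneg fun k _ => mul_nonneg (Torus.freqNormSq_nonneg k) (sq_nonneg _))

end Pieces

/-! ## §3 Carrier-free window maps are Fourier multipliers on the split -/

section Multiplier

variable {T₀ : ℝ} {𝔹 : Torus.Visc4 (Fin 3)} {lo' hi' : ℝ} {b : ℝ → VF} {T : ℝ → ℝ → (V2 →L[ℝ] V2)}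

/-- No mode grows along a window propagator whose carrier vanishes pointwise (`norm_sq_fcoeff_carrierFree_decay`). [folklore] -/
theorem norm_fc_le_of_carrier_zero (h𝔹 : Torus.NearIso 𝔹 lo' hi') (hlo' : 0 < lo') (hb : ∀ r y, b r y = 0)
    (hT : Torus.IsPropagator T₀ b 𝔹 T) {s t : ℝ} (hs : 0 ≤ s) (hst : s ≤ t) (htT : t ≤ T₀) (hsT : s < T₀) (x : V2)
    (hx : Torus.IsWeaklyDivFree (x : VF)) (k : Fin 3 → ℤ) : ‖fc (T s t x) k‖ ≤ ‖fc x k‖ := by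
  obtain rfl : b = fun (_ : ℝ) (_ : UnitAddTorus (Fin 3)) => (0 : EuclideanSpace ℝ (Fin 3)) := funext fun r => funext fun y => hb r y
  have h := norm_sq_fcoeff_carrierFree_decay h𝔹 hlo' hT hs hst htT hsT x hx k
  have hE : Real.exp (-(8 * Real.pi ^ 2 * lo' * Torus.freqNormSq k * (t - s))) ≤ 1 := by
    rw [Real.exp_le_one_iff]
    have : 0 ≤ 8 * Real.pi ^ 2 * lo' * Torus.freqNormSq k * (t - s) :=
      mul_nonneg (mul_nonneg (by positivity) (Torus.freqNormSq_nonneg k)) (by linarith)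
    linarith
  have h2 : ‖fc (T s t x) k‖ ^ 2 ≤ ‖fc x k‖ ^ 2 := h.trans (by nlinarith [sq_nonneg ‖fc x k‖])
  have := Real.sqrt_le_sqrt h2
  rwa [Real.sqrt_sq (norm_nonneg _), Real.sqrt_sq (norm_nonneg _)] at this

/-- A carrier-free window map keeps Fourier supports: `x̂(k) = 0 ⇒ 𝓕(T s t x)(k) = 0` (weakly divergence-free `x`). [folklore] -/
theorem fc_apply_eq_zero_of_carrier_zero (h𝔹 : Torus.NearIso 𝔹 lo' hi') (hlo' : 0 < lo') (hb : ∀ r y, b r y = 0)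
    (hT : Torus.IsPropagator T₀ b 𝔹 T) {s t : ℝ} (hs : 0 ≤ s) (hst : s ≤ t) (htT : t ≤ T₀) (x : V2)
    (hx : Torus.IsWeaklyDivFree (x : VF)) {k : Fin 3 → ℤ} (hk : fc x k = 0) : fc (T s t x) k = 0 := by
  rcases eq_or_lt_of_le (hst.trans htT) with hsT | hsT
  · have hts : t = s := le_antisymm (hsT ▸ htT) hst
    rw [hts, hT.self_of_divFree s hs (le_of_eq hsT) x hx, hk]
  · have h := norm_fc_le_of_carrier_zero h𝔹 hlo' hb hT hs hst htT hsT x hx k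
    rw [hk, norm_zero] at h
    exact norm_le_zero_iff.1 h

/-- **The adjoint of a carrier-free window map keeps Fourier supports** (the adjoint is the carrier-free propagator of the transposed tensor on the
reversed window, `IsPropagator.adjoint_eq`). [folklore] -/
theorem fc_adjoint_eq_zero_of_carrier_zero (h𝔹 : Torus.NearIso 𝔹 lo' hi') (hlo' : 0 < lo')
    (hT : Torus.IsPropagator T₀ (fun (_ : ℝ) (_ : UnitAddTorus (Fin 3)) => (0 : EuclideanSpace ℝ (Fin 3))) 𝔹 T)
    {s t : ℝ} (hs : 0 ≤ s) (hst : s ≤ t) (htT : t ≤ T₀) (ζ : V2) (hζ : Torus.IsWeaklyDivFree (ζ : VF)) {k : Fin 3 → ℤ}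
    (hk : fc ζ k = 0) : fc (ContinuousLinearMap.adjoint (T s t) ζ) k = 0 := by
  rcases hst.eq_or_lt with hEq | hLt
  · subst hEq
    have hself : T s s = (Torus.divFreeL2 (Fin 3)).starProjection := by
      refine ContinuousLinearMap.ext fun y => ?_
      rw [hT.apply_eq_apply_starProjection s s y]
      exact hT.self_of_divFree s hs htT _ (Torus.isWeaklyDivFree_starProjection y)
    rw [hself, (isSelfAdjoint_starProjection (Torus.divFreeL2 (Fin 3))).adjoint_eq]
    have h := Torus.norm_mFourierCoeff_starProjection_le ζ k
    have h0 : ‖fc ((Torus.divFreeL2 (Fin 3)).starProjection ζ) k‖ ≤ 0 := by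
      calc ‖fc ((Torus.divFreeL2 (Fin 3)).starProjection ζ) k‖ ≤ ‖fc ζ k‖ := h
        _ = 0 := by rw [hk, norm_zero]
    exact norm_le_zero_iff.1 h0
  · have hb : MemLp (Torus.stLift (fun (_ : ℝ) (_ : UnitAddTorus (Fin 3)) => (0 : EuclideanSpace ℝ (Fin 3)))) ∞
        (volume.restrict (Ioo 0 T₀ ×ˢ (univ : Set (EuclideanSpace ℝ (Fin 3))))) := memLp_top_const 0
    have hbdiv : ∀ᵐ τ ∂(volume.restrict (Ioo (0:ℝ) T₀)),
        Torus.IsWeaklyDivFree ((fun (_ : ℝ) (_ : UnitAddTorus (Fin 3)) => (0 : EuclideanSpace ℝ (Fin 3))) τ) :=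
      ae_of_all _ fun τ θ hθ => by simp
    rw [hT.adjoint_eq h𝔹 hlo' hb hbdiv hs hLt htT]
    have h𝔹' := (Torus.nearIso_majorTranspose_iff 𝔹 lo' hi').2 h𝔹
    have hV := Torus.isPropagator_propagator h𝔹' hlo'
      (Torus.memLp_top_stLift_reversed_window hb hs htT) (Torus.ae_isWeaklyDivFree_reversed_window hbdiv hs htT)
    exact fc_apply_eq_zero_of_carrier_zero h𝔹' hlo' (fun r y => by simp) hV le_rfl (by linarith) le_rfl ζ hζ hk

end Multiplier

/-! ## §4 Losses add over the split -/

section Additivity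

variable {T₀ : ℝ} {𝔹 : Torus.Visc4 (Fin 3)} {lo' hi' : ℝ} {T : ℝ → ℝ → (V2 →L[ℝ] V2)} {N : ℕ} {x xu xs : V2}

/-- **Forward coarse losses add over the split**: `q_T(x) = q_T(xu) + q_T(xs)`. [folklore] -/
theorem lossFwd_ballSplit (h𝔹 : Torus.NearIso 𝔹 lo' hi') (hlo' : 0 < lo')
    (hT : Torus.IsPropagator T₀ (fun (_ : ℝ) (_ : UnitAddTorus (Fin 3)) => (0 : EuclideanSpace ℝ (Fin 3))) 𝔹 T)
    {s t : ℝ} (hs : 0 ≤ s) (hst : s ≤ t) (htT : t ≤ T₀) (hsum : xu + xs = x)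
    (hfu : ∀ k, fc xu k = if k ∈ Torus.freqBall (d := Fin 3) N then fc x k else 0)
    (hfs : ∀ k, fc xs k = if k ∈ Torus.freqBall (d := Fin 3) N then 0 else fc x k)
    (hxu : Torus.IsWeaklyDivFree (xu : VF)) (hxs : Torus.IsWeaklyDivFree (xs : VF)) :
    lossFwd (T s t) x = lossFwd (T s t) xu + lossFwd (T s t) xs := by
  unfold lossFwd
  rw [← hsum]
  refine LossCurrency.loss_add_of_orthogonal (inner_ballSplit_eq_zero hfu hfs) (inner_eq_zero_of_fc_disjoint fun k => ?_)
  by_cases hk : k ∈ Torus.freqBall (d := Fin 3) N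
  · right
    exact fc_apply_eq_zero_of_carrier_zero h𝔹 hlo' (fun _ _ => rfl) hT hs hst htT xs hxs (by rw [hfs k, if_pos hk])
  · left
    exact fc_apply_eq_zero_of_carrier_zero h𝔹 hlo' (fun _ _ => rfl) hT hs hst htT xu hxu (by rw [hfu k, if_neg hk])

/-- **Adjoint coarse losses add over the split**: `q*_T(ζ) = q*_T(ζu) + q*_T(ζs)`. [folklore] -/
theorem lossAdj_ballSplit (h𝔹 : Torus.NearIso 𝔹 lo' hi') (hlo' : 0 < lo')
    (hT : Torus.IsPropagator T₀ (fun (_ : ℝ) (_ : UnitAddTorus (Fin 3)) => (0 : EuclideanSpace ℝ (Fin 3))) 𝔹 T)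
    {s t : ℝ} (hs : 0 ≤ s) (hst : s ≤ t) (htT : t ≤ T₀) (hsum : xu + xs = x)
    (hfu : ∀ k, fc xu k = if k ∈ Torus.freqBall (d := Fin 3) N then fc x k else 0)
    (hfs : ∀ k, fc xs k = if k ∈ Torus.freqBall (d := Fin 3) N then 0 else fc x k)
    (hxu : Torus.IsWeaklyDivFree (xu : VF)) (hxs : Torus.IsWeaklyDivFree (xs : VF)) :
    lossAdj (T s t) x = lossAdj (T s t) xu + lossAdj (T s t) xs := by
  unfold lossAdj
  rw [← hsum]
  refine LossCurrency.loss_add_of_orthogonal (inner_ballSplit_eq_zero hfu hfs) (inner_eq_zero_of_fc_disjoint fun k => ?_)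
  by_cases hk : k ∈ Torus.freqBall (d := Fin 3) N
  · right
    exact fc_adjoint_eq_zero_of_carrier_zero h𝔹 hlo' hT hs hst htT xs hxs (by rw [hfs k, if_pos hk])
  · left
    exact fc_adjoint_eq_zero_of_carrier_zero h𝔹 hlo' hT hs hst htT xu hxu (by rw [hfu k, if_neg hk])

end Additivity

/-! ## §5 The loss currency of the two pieces -/

section Currency

variable {T₀ : ℝ} {𝔹 : Torus.Visc4 (Fin 3)} {lo' hi' : ℝ} {b : ℝ → VF} {T : ℝ → ℝ → (V2 →L[ℝ] V2)} {N : ℕ} {x xu xs : V2}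

/-- **Modewise forward coarse loss** (carrier vanishing pointwise): for weakly divergence-free `x` and every finite `S`,
`Σ_{k∈S} (1 − exp(−8π² lo′ |k|² (t−s)))·‖x̂ k‖² ≤ lossFwd (T s t) x`. [folklore] -/
theorem lossFwd_ge_sum_modes (h𝔹 : Torus.NearIso 𝔹 lo' hi') (hlo' : 0 < lo') (hb : ∀ r y, b r y = 0) (hT : Torus.IsPropagator T₀ b 𝔹 T)
    {s t : ℝ} (hs : 0 ≤ s) (hst : s ≤ t) (htT : t ≤ T₀) (x : V2) (hx : Torus.IsWeaklyDivFree (x : VF)) (S : Finset (Fin 3 → ℤ)) :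
    ∑ k ∈ S, (1 - Real.exp (-(8 * Real.pi ^ 2 * lo' * Torus.freqNormSq k * (t - s)))) * ‖fc x k‖ ^ 2 ≤ lossFwd (T s t) x := by
  obtain rfl : b = fun (_ : ℝ) (_ : UnitAddTorus (Fin 3)) => (0 : EuclideanSpace ℝ (Fin 3)) := funext fun r => funext fun y => hb r y
  unfold lossFwd
  rcases eq_or_lt_of_le (hst.trans htT) with hsT | hsT
  · have hts : t = s := le_antisymm (hsT ▸ htT) hst
    have h0 : ∀ k : Fin 3 → ℤ, (1 - Real.exp (-(8 * Real.pi ^ 2 * lo' * Torus.freqNormSq k * (t - s)))) * ‖fc x k‖ ^ 2 = 0 := fun k => by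
      rw [hts, sub_self, mul_zero, neg_zero, Real.exp_zero, sub_self, zero_mul]
    rw [Finset.sum_eq_zero fun k _ => h0 k, hts, hT.self_of_divFree s hs (le_of_eq hsT) x hx, sub_self]
  have hA := hasSum_norm_sq_fcoeff x
  have hB := hasSum_norm_sq_fcoeff (T s t x)
  have hD := hA.sub hB
  have hnn : ∀ k : Fin 3 → ℤ, 0 ≤ ‖mFourierCoeff (EuclideanSpace.complexify ∘ ⇑x) k‖ ^ 2 -
      ‖mFourierCoeff (EuclideanSpace.complexify ∘ ⇑(T s t x)) k‖ ^ 2 := fun k => by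
    have h := norm_fc_le_of_carrier_zero h𝔹 hlo' (fun _ _ => rfl) hT hs hst htT hsT x hx k
    rw [fc, fc] at h
    nlinarith [h, norm_nonneg (mFourierCoeff (EuclideanSpace.complexify ∘ ⇑(T s t x)) k)]
  have hle := sum_le_hasSum S (fun k _ => hnn k) hD
  refine le_trans (Finset.sum_le_sum fun k _ => ?_) hle
  have h := norm_sq_fcoeff_carrierFree_decay h𝔹 hlo' hT hs hst htT hsT x hx k
  rw [fc, fc] at h
  rw [fc]
  nlinarith [h, sq_nonneg ‖mFourierCoeff (EuclideanSpace.complexify ∘ ⇑x) k‖]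

/-- `(N+1)² ≤ 2(N²+1)`. [folklore] -/
theorem sq_succ_le_two_mul (N : ℕ) : ((N : ℝ) + 1) ^ 2 ≤ 2 * ((N : ℝ) ^ 2 + 1) := by nlinarith [sq_nonneg ((N : ℝ) - 1)]

/-- Saturation off the ball: `κτ(N+1)² ≥ 1` and `|k|² ≥ N²+1` give `1/4 ≤ 1 − exp(−κτ|k|²)`-type bounds; here in the form used below:
`1 ≤ κτ(N+1)²`, `0 ≤ κτ` ⇒ `1/4 ≤ 1 − exp(−κτ(N²+1))`. [folklore] -/
theorem quarter_le_one_sub_exp {κτ : ℝ} {N : ℕ} (h0 : 0 ≤ κτ) (hN2 : 1 ≤ κτ * ((N : ℝ) + 1) ^ 2) :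
    (1:ℝ) / 4 ≤ 1 - Real.exp (-(κτ * ((N : ℝ) ^ 2 + 1))) := by
  have h1 : (1:ℝ) / 2 ≤ κτ * ((N : ℝ) ^ 2 + 1) := by nlinarith [sq_succ_le_two_mul N]
  have h2 := half_min_one_le_one_sub_exp_neg (x := κτ * ((N : ℝ) ^ 2 + 1)) (by positivity)
  have h3 : (1:ℝ) / 2 ≤ min 1 (κτ * ((N : ℝ) ^ 2 + 1)) := le_min (by norm_num) h1
  linarith

/-- **The low piece pays in enstrophy (forward)**: with `κ = 8π² lo′`, `τ = t − s` and `κτN² ≤ 1`,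
`(κτ/2)·Σ_{|k|≤N} |k|²‖x̂ k‖² ≤ lossFwd (T s t) xu`. [folklore] -/
theorem lossFwd_low_ge (h𝔹 : Torus.NearIso 𝔹 lo' hi') (hlo' : 0 < lo') (hb : ∀ r y, b r y = 0) (hT : Torus.IsPropagator T₀ b 𝔹 T)
    {s t : ℝ} (hs : 0 ≤ s) (hst : s ≤ t) (htT : t ≤ T₀)
    (hfu : ∀ k, fc xu k = if k ∈ Torus.freqBall (d := Fin 3) N then fc x k else 0) (hxu : Torus.IsWeaklyDivFree (xu : VF))
    (hN1 : 8 * Real.pi ^ 2 * lo' * (t - s) * (N : ℝ) ^ 2 ≤ 1) :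
    8 * Real.pi ^ 2 * lo' * (t - s) / 2 * ∑ k ∈ Torus.freqBall (d := Fin 3) N, Torus.freqNormSq k * ‖fc x k‖ ^ 2 ≤ lossFwd (T s t) xu := by
  have h := lossFwd_ge_sum_modes h𝔹 hlo' hb hT hs hst htT xu hxu (Torus.freqBall (d := Fin 3) N)
  refine le_trans ?_ h
  rw [Finset.mul_sum]
  refine Finset.sum_le_sum fun k hk => ?_
  rw [hfu k, if_pos hk]
  have hk2 : Torus.freqNormSq k ≤ (N : ℝ) ^ 2 := Torus.mem_freqBall.1 hk
  have hκ0 : 0 ≤ 8 * Real.pi ^ 2 * lo' * (t - s) := mul_nonneg (by positivity) (by linarith)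
  set a : ℝ := 8 * Real.pi ^ 2 * lo' * Torus.freqNormSq k * (t - s) with ha
  have ha0 : 0 ≤ a := by rw [ha]; exact mul_nonneg (mul_nonneg (by positivity) (Torus.freqNormSq_nonneg k)) (by linarith)
  have ha1 : a ≤ 1 := by
    calc a = 8 * Real.pi ^ 2 * lo' * (t - s) * Torus.freqNormSq k := by rw [ha]; ring
      _ ≤ 8 * Real.pi ^ 2 * lo' * (t - s) * (N : ℝ) ^ 2 := mul_le_mul_of_nonneg_left hk2 hκ0
      _ ≤ 1 := hN1
  have hmin := half_min_one_le_one_sub_exp_neg ha0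
  rw [min_eq_right ha1] at hmin
  have e : 8 * Real.pi ^ 2 * lo' * (t - s) / 2 * (Torus.freqNormSq k * ‖fc x k‖ ^ 2) = a / 2 * ‖fc x k‖ ^ 2 := by rw [ha]; ring
  rw [e]
  exact mul_le_mul_of_nonneg_right hmin (sq_nonneg _)

/-- **The high piece is saturated (forward)**: with `κτ(N+1)² ≥ 1`, `‖xs‖²/4 ≤ lossFwd (T s t) xs`. [folklore] -/
theorem lossFwd_high_ge (h𝔹 : Torus.NearIso 𝔹 lo' hi') (hlo' : 0 < lo') (hb : ∀ r y, b r y = 0) (hT : Torus.IsPropagator T₀ b 𝔹 T)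
    {s t : ℝ} (hs : 0 ≤ s) (hst : s ≤ t) (htT : t ≤ T₀)
    (hfs : ∀ k, fc xs k = if k ∈ Torus.freqBall (d := Fin 3) N then 0 else fc x k)
    (hN2 : 1 ≤ 8 * Real.pi ^ 2 * lo' * (t - s) * ((N : ℝ) + 1) ^ 2) : ‖xs‖ ^ 2 / 4 ≤ lossFwd (T s t) xs := by
  have hsupp : ∀ k, fc xs k ≠ 0 → (N : ℝ) ^ 2 + 1 ≤ Torus.freqNormSq k := fun k hk => by
    by_cases hkb : k ∈ Torus.freqBall (d := Fin 3) N
    · exact absurd (by rw [hfs k, if_pos hkb]) hk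
    · exact freqNormSq_ge_of_not_mem_freqBall hkb
  have h := lossFwd_ge_of_supp h𝔹 hlo' hb hT hs hst htT xs (by positivity) hsupp
  have hκ0 : 0 ≤ 8 * Real.pi ^ 2 * lo' * (t - s) := mul_nonneg (by positivity) (by linarith)
  have hq := quarter_le_one_sub_exp hκ0 hN2
  have e : -(8 * Real.pi ^ 2 * lo' * ((N : ℝ) ^ 2 + 1) * (t - s)) = -(8 * Real.pi ^ 2 * lo' * (t - s) * ((N : ℝ) ^ 2 + 1)) := by ring
  rw [e] at h
  nlinarith [hq, h, sq_nonneg ‖xs‖]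

/-- **The low piece pays in enstrophy (adjoint)**: `(κτ/2)·Σ_{|k|≤N} |k|²‖ζ̂ k‖² ≤ lossAdj (T s t) ζu` when `κτN² ≤ 1`. [folklore] -/
theorem lossAdj_low_ge (h𝔹 : Torus.NearIso 𝔹 lo' hi') (hlo' : 0 < lo')
    (hT : Torus.IsPropagator T₀ (fun (_ : ℝ) (_ : UnitAddTorus (Fin 3)) => (0 : EuclideanSpace ℝ (Fin 3))) 𝔹 T)
    {s t : ℝ} (hs : 0 ≤ s) (hst : s ≤ t) (htT : t ≤ T₀)
    (hfu : ∀ k, fc xu k = if k ∈ Torus.freqBall (d := Fin 3) N then fc x k else 0) (hxu : Torus.IsWeaklyDivFree (xu : VF))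
    (hN1 : 8 * Real.pi ^ 2 * lo' * (t - s) * (N : ℝ) ^ 2 ≤ 1) :
    8 * Real.pi ^ 2 * lo' * (t - s) / 2 * ∑ k ∈ Torus.freqBall (d := Fin 3) N, Torus.freqNormSq k * ‖fc x k‖ ^ 2 ≤ lossAdj (T s t) xu := by
  rcases hst.eq_or_lt with hEq | hLt
  · subst hEq
    rw [sub_self, mul_zero, zero_div, zero_mul]
    exact LossCurrency.lossAdj_nonneg (hT.norm_le s s) xu
  · have hb : MemLp (Torus.stLift (fun (_ : ℝ) (_ : UnitAddTorus (Fin 3)) => (0 : EuclideanSpace ℝ (Fin 3)))) ∞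
        (volume.restrict (Ioo 0 T₀ ×ˢ (univ : Set (EuclideanSpace ℝ (Fin 3))))) := memLp_top_const 0
    have hbdiv : ∀ᵐ τ ∂(volume.restrict (Ioo (0:ℝ) T₀)),
        Torus.IsWeaklyDivFree ((fun (_ : ℝ) (_ : UnitAddTorus (Fin 3)) => (0 : EuclideanSpace ℝ (Fin 3))) τ) :=
      ae_of_all _ fun τ θ hθ => by simp
    unfold lossAdj
    rw [hT.adjoint_eq h𝔹 hlo' hb hbdiv hs hLt htT]
    have h𝔹' := (Torus.nearIso_majorTranspose_iff 𝔹 lo' hi').2 h𝔹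
    have hV := Torus.isPropagator_propagator h𝔹' hlo'
      (Torus.memLp_top_stLift_reversed_window hb hs htT) (Torus.ae_isWeaklyDivFree_reversed_window hbdiv hs htT)
    have h := lossFwd_low_ge (N := N) (x := x) h𝔹' hlo' (fun r y => by simp) hV le_rfl (by linarith) le_rfl hfu hxu (by rw [sub_zero]; exact hN1)
    rw [sub_zero] at h
    exact h

/-- **The high piece is saturated (adjoint)**: `‖ζs‖²/4 ≤ lossAdj (T s t) ζs` when `κτ(N+1)² ≥ 1`. [folklore] -/
theorem lossAdj_high_ge (h𝔹 : Torus.NearIso 𝔹 lo' hi') (hlo' : 0 < lo')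
    (hT : Torus.IsPropagator T₀ (fun (_ : ℝ) (_ : UnitAddTorus (Fin 3)) => (0 : EuclideanSpace ℝ (Fin 3))) 𝔹 T)
    {s t : ℝ} (hs : 0 ≤ s) (hst : s ≤ t) (htT : t ≤ T₀)
    (hfs : ∀ k, fc xs k = if k ∈ Torus.freqBall (d := Fin 3) N then 0 else fc x k)
    (hN2 : 1 ≤ 8 * Real.pi ^ 2 * lo' * (t - s) * ((N : ℝ) + 1) ^ 2) : ‖xs‖ ^ 2 / 4 ≤ lossAdj (T s t) xs := by
  have hsupp : ∀ k, fc xs k ≠ 0 → (N : ℝ) ^ 2 + 1 ≤ Torus.freqNormSq k := fun k hk => by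
    by_cases hkb : k ∈ Torus.freqBall (d := Fin 3) N
    · exact absurd (by rw [hfs k, if_pos hkb]) hk
    · exact freqNormSq_ge_of_not_mem_freqBall hkb
  have h := lossAdj_ge_of_supp h𝔹 hlo' hT hs hst htT xs (by positivity) hsupp
  have hκ0 : 0 ≤ 8 * Real.pi ^ 2 * lo' * (t - s) := mul_nonneg (by positivity) (by linarith)
  have hq := quarter_le_one_sub_exp hκ0 hN2
  have e : -(8 * Real.pi ^ 2 * lo' * ((N : ℝ) ^ 2 + 1) * (t - s)) = -(8 * Real.pi ^ 2 * lo' * (t - s) * ((N : ℝ) ^ 2 + 1)) := by ring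
  rw [e] at h
  nlinarith [hq, h, sq_nonneg ‖xs‖]

end Currency

end Summit.AnomalousDissipation.AnomalousDissipation.Theorems.SolenoidalFractalHomogenisation.LagrangianStep.VmodFlat

end
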